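import Literature.Probability.LatticeModels.PolymerPushforward
import HarnessLib

/-!
# High-temperature current clustering for TcThermcert1's Hypothesis C — part 2: polymer combinatorics

Helper file for route `TcThermcert1` (crux K1′ `ThermalStiffnessCeilingU8b8_le_7o44`, item `stmt-Ventures-24560`; line
`Cruxes/ThermalStiffnessCeilingU8b8_le_7o44/Lines/gauge_qbp_far_seam.lean`, small-`β` rung `stub_currentClustering8_smallBeta`).
Pure finite combinatorics of the polymer expansion used in parts 3–5, for an abstract set of CELLS `V` (the local terms of the
Hamiltonian) with vertex sets `verts : V → Finset α` (their supports) and a set of ROOT sites `R₀` (the two ends of the bond carrying the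
current):

* §1 Möbius inversion on the Boolean lattice with values in an additive group (`Σ_{C ⊆ L} Σ_{B ⊆ C} (−1)^{|C∖B|} f B = f L`) and
  the splitting of a powerset sum over a disjoint union.
* §2 reachability of sites from `R₀` through the cells of `K` (`Relation.ReflTransGen` of "lie in a common cell of `K`"), the cells
  of `Q` ATTACHED to `R₀` (those with a reachable vertex), and the exact fibration of `Q ↦ (attached part, far part)`:
  `Σ_{Q ⊆ P} F Q = Σ_{K ⊆ P admissible} Σ_{T ⊆ far(K)} F (K ∪ T)` (`sum_powerset_eq_sum_adm_sum_far`) — admissible = every cell of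
  `K` is attached through `K` itself; far = no vertex reachable through `K`.
(Part 2b, `TcThermcert1HighTempRootedAnimals.lean`: rooted connectivity, the distance bound and the rooted animal bound.)

[cite: Ueltschi1999, §2.3 (polymers = connected families of interaction terms)]; [cite: FriedliVelenik2017, §5.2 and Lemma 3.38].
No physics; no definitions; no `sorry`. Nothing here bears on `T_c` or on superconductivity in the Hubbard model.
-/

namespace Summit.Ventures.CertifiedManyBodySolver.Theorems.TcThermcert1.HighTempCurrentClustering

open Finset
open Literature.Probability.LatticeModels
open scoped Classical

/-! ## §1 Möbius inversion and powersets of disjoint unions -/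

section Moebius

variable {V : Type*} [DecidableEq V]

/-- **Möbius inversion on the Boolean lattice** (additive-group values, `ℤ`-action):
`Σ_{C ⊆ L} Σ_{B ⊆ C} (−1)^{|C ∖ B|} • f B = f L`. [folklore] -/
theorem sum_powerset_sum_powerset_neg_one_pow_smul {β : Type*} [AddCommGroup β] (f : Finset V → β) (L : Finset V) :
    ∑ C ∈ L.powerset, ∑ B ∈ C.powerset, ((-1 : ℤ) ^ (C \ B).card) • f B = f L := by
  rw [Finset.sum_comm' (t' := L.powerset) (s' := fun B => Finset.Icc B L) (by
    intro C B
    simp only [Finset.mem_powerset, Finset.mem_Icc]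
    exact ⟨fun h => ⟨⟨h.2, h.1⟩, h.2.trans h.1⟩, fun h => ⟨h.1.2, h.1.1⟩⟩)]
  have inner : ∀ B ∈ L.powerset,
      ∑ C ∈ Finset.Icc B L, ((-1 : ℤ) ^ (C \ B).card) • f B = if B = L then f L else 0 := by
    intro B hB
    have hBL : B ⊆ L := Finset.mem_powerset.1 hB
    rw [Finset.Icc_eq_image_powerset hBL, Finset.sum_image]
    · have hT : ∀ T ∈ (L \ B).powerset, ((-1 : ℤ) ^ ((B ∪ T) \ B).card) • f B = ((-1 : ℤ) ^ T.card) • f B := by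
        intro T hT
        have hdisj : Disjoint B T := Finset.disjoint_of_subset_right (Finset.mem_powerset.1 hT) Finset.disjoint_sdiff
        rw [Finset.union_sdiff_cancel_left hdisj]
      rw [Finset.sum_congr rfl hT, ← Finset.sum_smul, Finset.sum_powerset_neg_one_pow_card]
      by_cases hBL' : B = L
      · subst hBL'
        simp
      · have hne : L \ B ≠ ∅ := fun h => hBL' (Finset.Subset.antisymm hBL (Finset.sdiff_eq_empty_iff_subset.1 h))
        simp [hne, hBL']
    · intro T₁ hT₁ T₂ hT₂ hT
      have h₁ : Disjoint B T₁ := Finset.disjoint_of_subset_right (Finset.mem_powerset.1 hT₁) Finset.disjoint_sdiff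
      have h₂ : Disjoint B T₂ := Finset.disjoint_of_subset_right (Finset.mem_powerset.1 hT₂) Finset.disjoint_sdiff
      rw [← Finset.union_sdiff_cancel_left h₁, ← Finset.union_sdiff_cancel_left h₂]
      exact congrArg (· \ B) hT
  rw [Finset.sum_congr rfl inner, Finset.sum_ite_eq' L.powerset L (fun _ => f L), if_pos (Finset.mem_powerset.2 Finset.Subset.rfl)]

/-- Subsets of a disjoint union are unions of pairs of subsets. [folklore] -/
theorem sum_powerset_union_eq_sum_sum' {β : Type*} [AddCommMonoid β] {K T : Finset V} (hKT : Disjoint K T) (g : Finset V → β) :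
    ∑ S ∈ (K ∪ T).powerset, g S = ∑ A ∈ K.powerset, ∑ B ∈ T.powerset, g (A ∪ B) := by
  rw [← Finset.sum_product']
  symm
  refine Finset.sum_nbij' (fun p => p.1 ∪ p.2) (fun S => (S ∩ K, S ∩ T)) ?_ ?_ ?_ ?_ ?_
  · intro p hp
    obtain ⟨h1, h2⟩ := Finset.mem_product.1 hp
    exact Finset.mem_powerset.2 (Finset.union_subset_union (Finset.mem_powerset.1 h1) (Finset.mem_powerset.1 h2))
  · intro S hS
    exact Finset.mem_product.2 ⟨Finset.mem_powerset.2 Finset.inter_subset_right, Finset.mem_powerset.2 Finset.inter_subset_right⟩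
  · intro p hp
    obtain ⟨h1, h2⟩ := Finset.mem_product.1 hp
    have h1' := Finset.mem_powerset.1 h1
    have h2' := Finset.mem_powerset.1 h2
    ext <;> simp only [Finset.mem_inter, Finset.mem_union]
    · constructor
      · rintro ⟨h | h, hK⟩
        · exact h
        · exact absurd hK (Finset.disjoint_right.1 hKT (h2' h))
      · exact fun h => ⟨Or.inl h, h1' h⟩
    · constructor
      · rintro ⟨h | h, hT⟩
        · exact absurd hT (Finset.disjoint_left.1 hKT (h1' h))
        · exact h
      · exact fun h => ⟨Or.inr h, h2' h⟩
  · intro S hS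
    have hS' := Finset.mem_powerset.1 hS
    ext z
    simp only [Finset.mem_union, Finset.mem_inter]
    constructor
    · rintro (⟨h, -⟩ | ⟨h, -⟩) <;> exact h
    · intro hz
      rcases Finset.mem_union.1 (hS' hz) with h | h
      · exact Or.inl ⟨hz, h⟩
      · exact Or.inr ⟨hz, h⟩
  · intro p _; rfl

/-- Complements in a disjoint union: `|(K ∪ T) ∖ (A ∪ B)| = |K ∖ A| + |T ∖ B|` for `A ⊆ K`, `B ⊆ T`, `K ∩ T = ∅`. [folklore] -/
theorem card_union_sdiff_union {K T A B : Finset V} (hKT : Disjoint K T) (hA : A ⊆ K) (hB : B ⊆ T) :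
    ((K ∪ T) \ (A ∪ B)).card = (K \ A).card + (T \ B).card := by
  have h : (K ∪ T) \ (A ∪ B) = (K \ A) ∪ (T \ B) := by
    ext z
    simp only [Finset.mem_sdiff, Finset.mem_union, not_or]
    constructor
    · rintro ⟨hz | hz, hA', hB'⟩
      · exact Or.inl ⟨hz, hA'⟩
      · exact Or.inr ⟨hz, hB'⟩
    · rintro (⟨hz, hA'⟩ | ⟨hz, hB'⟩)
      · exact ⟨Or.inl hz, hA', fun h => Finset.disjoint_left.1 hKT hz (hB h)⟩
      · exact ⟨Or.inr hz, fun h => Finset.disjoint_right.1 hKT hz (hA h), hB'⟩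
  rw [h, Finset.card_union_of_disjoint (Finset.disjoint_of_subset_left Finset.sdiff_subset
    (Finset.disjoint_of_subset_right Finset.sdiff_subset hKT))]

end Moebius

/-! ## §2 Reachability from the roots, attached cells, and the attached/far fibration -/

section Reach

variable {α V : Type*} [DecidableEq α] [DecidableEq V] {verts : V → Finset α}

omit [DecidableEq α] [DecidableEq V] in
/-- Reachability through the cells is monotone in the set of cells. [folklore] -/
theorem reach_mono {K K' : Finset V} (h : K ⊆ K') {x y : α}
    (hxy : Relation.ReflTransGen (fun x y : α => ∃ Z ∈ K, x ∈ verts Z ∧ y ∈ verts Z) x y) :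
    Relation.ReflTransGen (fun x y : α => ∃ Z ∈ K', x ∈ verts Z ∧ y ∈ verts Z) x y := by
  induction hxy with
  | refl => exact Relation.ReflTransGen.refl
  | tail _ hbc ih =>
    obtain ⟨Z, hZ, ha, hb⟩ := hbc
    exact ih.tail ⟨Z, h hZ, ha, hb⟩

omit [DecidableEq α] [DecidableEq V] in
/-- **Attached cells carry all of the reachability**: a site reachable from a root through `K` is reachable through the cells of
`K` that have a vertex reachable from the roots. [folklore] -/
theorem reach_attached {K : Finset V} {R₀ : Finset α} {x y : α} (hx : x ∈ R₀)
    (hxy : Relation.ReflTransGen (fun x y : α => ∃ Z ∈ K, x ∈ verts Z ∧ y ∈ verts Z) x y) :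
    Relation.ReflTransGen (fun x' y' : α => ∃ Z ∈ K.filter (fun Z => ∃ w ∈ verts Z, ∃ r ∈ R₀,
        Relation.ReflTransGen (fun x y : α => ∃ Z ∈ K, x ∈ verts Z ∧ y ∈ verts Z) r w), x' ∈ verts Z ∧ y' ∈ verts Z) x y := by
  induction hxy with
  | refl => exact Relation.ReflTransGen.refl
  | @tail b c hxb hbc ih =>
    obtain ⟨Z, hZK, hbZ, hcZ⟩ := hbc
    exact ih.tail ⟨Z, Finset.mem_filter.2 ⟨hZK, b, hbZ, x, hx, hxb⟩, hbZ, hcZ⟩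

omit [DecidableEq α] in
/-- **Far cells do not extend the reachability**: adding to `K` cells none of whose vertices is reachable through `K` does not make
new sites reachable from the roots. [folklore] -/
theorem reach_union_far {K T : Finset V} {R₀ : Finset α}
    (hT : ∀ Z ∈ T, ∀ w ∈ verts Z, ¬ ∃ r ∈ R₀, Relation.ReflTransGen (fun x y : α => ∃ Z ∈ K, x ∈ verts Z ∧ y ∈ verts Z) r w)
    {x y : α} (hx : x ∈ R₀)
    (hxy : Relation.ReflTransGen (fun x y : α => ∃ Z ∈ K ∪ T, x ∈ verts Z ∧ y ∈ verts Z) x y) :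
    ∃ r ∈ R₀, Relation.ReflTransGen (fun x y : α => ∃ Z ∈ K, x ∈ verts Z ∧ y ∈ verts Z) r y := by
  induction hxy with
  | refl => exact ⟨x, hx, Relation.ReflTransGen.refl⟩
  | @tail b c _ hbc ih =>
    obtain ⟨r, hr, hrb⟩ := ih
    obtain ⟨Z, hZ, hbZ, hcZ⟩ := hbc
    rcases Finset.mem_union.1 hZ with hZK | hZT
    · exact ⟨r, hr, hrb.tail ⟨Z, hZK, hbZ, hcZ⟩⟩
    · exact absurd ⟨r, hr, hrb⟩ (hT Z hZT b hbZ)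

omit [DecidableEq α] [DecidableEq V] in
/-- The attached part of any `Q` is ADMISSIBLE: each of its cells has a vertex reachable from the roots through the attached part
itself. [folklore] -/
theorem attached_admissible (Q : Finset V) (R₀ : Finset α) :
    ∀ Z ∈ Q.filter (fun Z => ∃ w ∈ verts Z, ∃ r ∈ R₀,
        Relation.ReflTransGen (fun x y : α => ∃ Z ∈ Q, x ∈ verts Z ∧ y ∈ verts Z) r w),
      ∃ w ∈ verts Z, ∃ r ∈ R₀, Relation.ReflTransGen (fun x y : α => ∃ Z' ∈ Q.filter (fun Z => ∃ w ∈ verts Z, ∃ r ∈ R₀,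
        Relation.ReflTransGen (fun x y : α => ∃ Z ∈ Q, x ∈ verts Z ∧ y ∈ verts Z) r w), x ∈ verts Z' ∧ y ∈ verts Z') r w := by
  intro Z hZ
  obtain ⟨-, w, hw, r, hr, hrw⟩ := Finset.mem_filter.1 hZ
  exact ⟨w, hw, r, hr, reach_attached hr hrw⟩

omit [DecidableEq α] in
/-- The non-attached cells of `Q` are FAR from the attached part: none of their vertices is reachable through it. [folklore] -/
theorem sdiff_attached_far (Q : Finset V) (R₀ : Finset α) :
    ∀ Z ∈ Q \ Q.filter (fun Z => ∃ w ∈ verts Z, ∃ r ∈ R₀,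
        Relation.ReflTransGen (fun x y : α => ∃ Z ∈ Q, x ∈ verts Z ∧ y ∈ verts Z) r w),
      ∀ w ∈ verts Z, ¬ ∃ r ∈ R₀, Relation.ReflTransGen (fun x y : α => ∃ Z' ∈ Q.filter (fun Z => ∃ w ∈ verts Z, ∃ r ∈ R₀,
        Relation.ReflTransGen (fun x y : α => ∃ Z ∈ Q, x ∈ verts Z ∧ y ∈ verts Z) r w), x ∈ verts Z' ∧ y ∈ verts Z') r w := by
  intro Z hZ w hw h
  obtain ⟨hZQ, hZn⟩ := Finset.mem_sdiff.1 hZ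
  obtain ⟨r, hr, hrw⟩ := h
  exact hZn (Finset.mem_filter.2 ⟨hZQ, w, hw, r, hr, reach_mono (Finset.filter_subset _ Q) hrw⟩)

omit [DecidableEq α] [DecidableEq V] in
/-- An admissible `K` and a far `T` are disjoint. [folklore] -/
theorem disjoint_of_admissible_far {K T : Finset V} {R₀ : Finset α}
    (hK : ∀ Z ∈ K, ∃ w ∈ verts Z, ∃ r ∈ R₀, Relation.ReflTransGen (fun x y : α => ∃ Z ∈ K, x ∈ verts Z ∧ y ∈ verts Z) r w)
    (hT : ∀ Z ∈ T, ∀ w ∈ verts Z, ¬ ∃ r ∈ R₀, Relation.ReflTransGen (fun x y : α => ∃ Z ∈ K, x ∈ verts Z ∧ y ∈ verts Z) r w) :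
    Disjoint K T := by
  rw [Finset.disjoint_left]
  intro Z hZK hZT
  obtain ⟨w, hw, h⟩ := hK Z hZK
  exact hT Z hZT w hw h

omit [DecidableEq α] in
/-- **The attached part of `K ∪ T` is `K`** when `K` is admissible and `T` is far from `K`. [folklore] -/
theorem attached_union_of_admissible_far {K T : Finset V} {R₀ : Finset α}
    (hK : ∀ Z ∈ K, ∃ w ∈ verts Z, ∃ r ∈ R₀, Relation.ReflTransGen (fun x y : α => ∃ Z ∈ K, x ∈ verts Z ∧ y ∈ verts Z) r w)
    (hT : ∀ Z ∈ T, ∀ w ∈ verts Z, ¬ ∃ r ∈ R₀, Relation.ReflTransGen (fun x y : α => ∃ Z ∈ K, x ∈ verts Z ∧ y ∈ verts Z) r w) :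
    (K ∪ T).filter (fun Z => ∃ w ∈ verts Z, ∃ r ∈ R₀,
        Relation.ReflTransGen (fun x y : α => ∃ Z ∈ K ∪ T, x ∈ verts Z ∧ y ∈ verts Z) r w) = K := by
  ext Z
  rw [Finset.mem_filter, Finset.mem_union]
  constructor
  · rintro ⟨hZ, w, hw, r, hr, hrw⟩
    obtain ⟨r', hr', hr'w⟩ := reach_union_far hT hr hrw
    rcases hZ with hZK | hZT
    · exact hZK
    · exact absurd ⟨r', hr', hr'w⟩ (hT Z hZT w hw)
  · intro hZK
    obtain ⟨w, hw, r, hr, hrw⟩ := hK Z hZK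
    exact ⟨Or.inl hZK, w, hw, r, hr, reach_mono Finset.subset_union_left hrw⟩

omit [DecidableEq α] in
open scoped Classical in
/-- **The attached/far fibration of the powerset.** Every `Q ⊆ P` is uniquely `K ∪ T` with `K` admissible (its attached part) and
`T` a set of cells of `P` far from `K`; hence for every additive `F`,
`Σ_{Q ⊆ P} F Q = Σ_{K ⊆ P admissible} Σ_{T ⊆ far_P(K)} F (K ∪ T)`. [cite: Ueltschi1999, §2.3 (resummation outside a polymer)] -/
theorem sum_powerset_eq_sum_adm_sum_far {β : Type*} [AddCommMonoid β] (P : Finset V) (R₀ : Finset α) (F : Finset V → β) :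
    ∑ Q ∈ P.powerset, F Q =
      ∑ K ∈ P.powerset.filter (fun K => ∀ Z ∈ K, ∃ w ∈ verts Z, ∃ r ∈ R₀,
          Relation.ReflTransGen (fun x y : α => ∃ Z ∈ K, x ∈ verts Z ∧ y ∈ verts Z) r w),
        ∑ T ∈ (P.filter (fun Z => ∀ w ∈ verts Z, ¬ ∃ r ∈ R₀,
          Relation.ReflTransGen (fun x y : α => ∃ Z ∈ K, x ∈ verts Z ∧ y ∈ verts Z) r w)).powerset, F (K ∪ T) := by
  -- group `Q` by its attached part
  have hmaps : ∀ Q ∈ P.powerset, Q.filter (fun Z => ∃ w ∈ verts Z, ∃ r ∈ R₀,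
      Relation.ReflTransGen (fun x y : α => ∃ Z ∈ Q, x ∈ verts Z ∧ y ∈ verts Z) r w) ∈
      P.powerset.filter (fun K => ∀ Z ∈ K, ∃ w ∈ verts Z, ∃ r ∈ R₀,
        Relation.ReflTransGen (fun x y : α => ∃ Z ∈ K, x ∈ verts Z ∧ y ∈ verts Z) r w) := by
    intro Q hQ
    rw [Finset.mem_filter]
    exact ⟨Finset.mem_powerset.2 ((Finset.filter_subset _ Q).trans (Finset.mem_powerset.1 hQ)), attached_admissible Q R₀⟩
  rw [← Finset.sum_fiberwise_of_maps_to hmaps]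
  refine Finset.sum_congr rfl fun K hK => ?_
  rw [Finset.mem_filter] at hK
  obtain ⟨hKP, hKadm⟩ := hK
  have hKP' : K ⊆ P := Finset.mem_powerset.1 hKP
  symm
  refine Finset.sum_nbij' (fun T => K ∪ T) (fun Q => Q \ K) ?_ ?_ ?_ ?_ (fun _ _ => rfl)
  · intro T hT
    have hT' := Finset.mem_powerset.1 hT
    have hfar : ∀ Z ∈ T, ∀ w ∈ verts Z, ¬ ∃ r ∈ R₀,
        Relation.ReflTransGen (fun x y : α => ∃ Z ∈ K, x ∈ verts Z ∧ y ∈ verts Z) r w :=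
      fun Z hZ => (Finset.mem_filter.1 (hT' hZ)).2
    rw [Finset.mem_filter]
    exact ⟨Finset.mem_powerset.2 (Finset.union_subset hKP' (hT'.trans (Finset.filter_subset _ P))),
      attached_union_of_admissible_far hKadm hfar⟩
  · intro Q hQ
    rw [Finset.mem_filter] at hQ
    obtain ⟨hQP, hQK⟩ := hQ
    refine Finset.mem_powerset.2 fun Z hZ => Finset.mem_filter.2 ⟨Finset.mem_powerset.1 hQP (Finset.mem_sdiff.1 hZ).1, ?_⟩
    have h := sdiff_attached_far (verts := verts) Q R₀
    rw [hQK] at h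
    exact h Z hZ
  · intro T hT
    have hT' := Finset.mem_powerset.1 hT
    have hfar : ∀ Z ∈ T, ∀ w ∈ verts Z, ¬ ∃ r ∈ R₀,
        Relation.ReflTransGen (fun x y : α => ∃ Z ∈ K, x ∈ verts Z ∧ y ∈ verts Z) r w :=
      fun Z hZ => (Finset.mem_filter.1 (hT' hZ)).2
    exact Finset.union_sdiff_cancel_left (disjoint_of_admissible_far hKadm hfar)
  · intro Q hQ
    rw [Finset.mem_filter] at hQ
    obtain ⟨-, hQK⟩ := hQ
    have hKQ : K ⊆ Q := by
      intro Z hZ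
      rw [← hQK] at hZ
      exact (Finset.mem_filter.1 hZ).1
    exact Finset.union_sdiff_of_subset hKQ

omit [DecidableEq α] [DecidableEq V] in
/-- **What is reachable**: a site reachable from a root is the root itself or a vertex of a cell of `K`. [folklore] -/
theorem eq_or_exists_cell_of_reach {K : Finset V} {r y : α}
    (h : Relation.ReflTransGen (fun x y : α => ∃ Z ∈ K, x ∈ verts Z ∧ y ∈ verts Z) r y) :
    y = r ∨ ∃ Z ∈ K, y ∈ verts Z := by
  rcases h.cases_tail with h | ⟨c, -, Z, hZ, -, hy⟩
  · exact Or.inl h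
  · exact Or.inr ⟨Z, hZ, hy⟩

end Reach

end Summit.Ventures.CertifiedManyBodySolver.Theorems.TcThermcert1.HighTempCurrentClustering
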